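import Summits.CriticalPhenomena.PercolationContinuityZ3.Theorems.PercNearOneGluingNoHeavyLowerTailSahiCTCRtThreeRowOneBlocks
import Summits.CriticalPhenomena.PercolationContinuityZ3.Theorems.PercNearOneGluingNoHeavyLowerTailSahiCTCRtThreeKleitmanBulkOne
import HarnessLib

/-!
# `NoHeavyLowerTail` (crux stmt-CriticalPhenomena-4575), P3 lane: the row with ONE DOUBLED POINT as THREE KLEITMAN ATOM SUMS on `σ`
# (deletions/links of the pair) plus pivot and window terms; nonnegativity of the atom sums for up-sets

Support file (seat `prim-l12-p3`, gen 51; `--supports stmt-CriticalPhenomena-4575`).  Memo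
`run/shared/lean/prim/prim-l12/FROM-prim-l12-p3-g51-ROW0-ALL-K-LEAN.md` §5.

`…RtThreeRowOneBlocks.coeff_ind_add_single_two_Rt_three_eq_blocks` + `…KleitmanBulk.sum_kap_eq_atomSum` (`#U ≤ 2`) +
`…KleitmanBulkOne.sum_kap_eq_atomSumOne` (`#U ≤ 1`) give
* `coeff_ind_add_single_two_Rt_three_eq_atomSums` : `coeff_{1_σ+2e_d} R_3 = atomSum(W_n)(X¹,Z¹;σ) + atomSum(W¹_n)(X⁰,Z¹;σ) + atomSum(W¹_n)(X¹,Z⁰;σ)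
  + [s^σ]Θ₁·Π·IE − [s^σ]Θ₂·Π·Y¹¹_{<2} − [s^σ]Θ₁·Π·(Y⁰⁰_{<3}+Y¹¹_{<2}) + crossing small pairs` (`n = #σ`, `W_n` the row-0 Kleitman bulk table,
  `W¹_n` its `t < 2` truncation) — the row-1 analogue of `coeff_ind_Rt_three_eq_atomSum_add`;
* `atomSum_congr_of_agree`, `mem_delV_iff_of_not_mem`, `mem_linkV_iff_of_not_mem`, `isUpperSet_insert_mem`, `atomSum_del_link_nonneg` : on `σ ∌ d` the
  deletion agrees with `𝒳` and the link with the up-set `{S : S + d ∈ 𝒳}`, so for up-sets the three atom sums are `≥ 0` for any nonnegative `J`-table.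
Next (memo §5): split the atom sums at tops with `≥ 4` points of `σ`, localise the rest and the window terms onto the 3-subsets of `σ`, and check the
local inequality on `Fin 3` (+ the `d`-flags) pair by pair (python: all 15 129 trace pairs pass, `n₁ = 5`).  No new definitions; nothing is
asserted about the crux.
-/

noncomputable section

open scoped Classical

namespace Summit.CriticalPhenomena.PercolationContinuityZ3.Theorems.SahiCTCForms

open Finset MvPolynomial SahiCTCGenFun

/-! ## ROW 1 as three Kleitman atom sums on `σ` plus pivot and window terms -/

variable {α : Type*} [DecidableEq α]

/-- **THE ROW WITH ONE DOUBLED POINT AS ATOM SUMS** (all families, `d ∉ σ`, `n = #σ`): the three Harris blocks of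
`coeff_ind_add_single_two_Rt_three_eq_blocks` expanded by the pivotal form of Kleitman's lemma (`sum_kap_eq_atomSum`, `sum_kap_eq_atomSumOne`):
`B_1 = atomSum(W_n)(X¹,Z¹;σ) + atomSum(W¹_n)(X⁰,Z¹;σ) + atomSum(W¹_n)(X¹,Z⁰;σ) + [s^σ]Θ₁·Π·IE − [s^σ]Θ₂·Π·Y¹¹_{<2} − [s^σ]Θ₁·Π·(Y⁰⁰_{<3}+Y¹¹_{<2}) + crossing`,
`W_n(a,b,c) = Σ_{t<3} C(n−a−b−c,t)·ω_{n−t}(b+c)` (the row-0 bulk table) and `W¹_n` the same with `t < 2`. [this work] -/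
theorem coeff_ind_add_single_two_Rt_three_eq_atomSums [Fintype α] (F G : Finset (Finset α)) {σ : Finset α} {d : α} (hd : d ∉ σ) :
    (((Rt 3 F G).coeff (ind σ + Finsupp.single d 2) : ℤ) : ℚ) =
      atomSum (fun a b c => ∑ t ∈ range 3, (((#σ - a - b - c).choose t : ℕ) : ℚ) *
          (if b + c < #σ - t then ((((#σ - t : ℕ) : ℚ)) * ((((#σ - t - 1).choose (b + c) : ℕ) : ℚ)))⁻¹ else 0))
        (fun _ _ _ => 0) (fun _ _ _ => 0) (fun _ _ _ => 0) (fun _ _ _ => 0) (linkV d F) (linkV d G) σ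
      + atomSum (fun a b c => ∑ t ∈ range 2, (((#σ - a - b - c).choose t : ℕ) : ℚ) *
          (if b + c < #σ - t then ((((#σ - t : ℕ) : ℚ)) * ((((#σ - t - 1).choose (b + c) : ℕ) : ℚ)))⁻¹ else 0))
        (fun _ _ _ => 0) (fun _ _ _ => 0) (fun _ _ _ => 0) (fun _ _ _ => 0) (delV d F) (linkV d G) σ
      + atomSum (fun a b c => ∑ t ∈ range 2, (((#σ - a - b - c).choose t : ℕ) : ℚ) *
          (if b + c < #σ - t then ((((#σ - t : ℕ) : ℚ)) * ((((#σ - t - 1).choose (b + c) : ℕ) : ℚ)))⁻¹ else 0))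
        (fun _ _ _ => 0) (fun _ _ _ => 0) (fun _ _ _ => 0) (fun _ _ _ => 0) (linkV d F) (delV d G) σ
      + (((gf (bySize (· < 2) : Finset (Finset α)) * (PiP *
          (gf (delV d F ∩ delV d G) + gf (linkV d F ∩ linkV d G) - gf (delV d F ∩ linkV d G) - gf (linkV d F ∩ delV d G)))).coeff (ind σ) : ℤ) : ℚ)
      - (((gf (bySize (· < 3) : Finset (Finset α)) * (PiP * gf (below 2 (linkV d F ∩ linkV d G)))).coeff (ind σ) : ℤ) : ℚ)
      - (((gf (bySize (· < 2) : Finset (Finset α)) * (PiP * (gf (below 3 (delV d F ∩ delV d G)) + gf (below 2 (linkV d F ∩ linkV d G))))).coeff (ind σ)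
          : ℤ) : ℚ)
      + ∑ S ∈ σ.powerset, ((((pairsAt (below 2 (linkV d F)) (below 3 (delV d G)) (σ \ S) : ℕ) : ℤ) : ℚ)
        + (((pairsAt (below 3 (delV d F)) (below 2 (linkV d G)) (σ \ S) : ℕ) : ℤ) : ℚ)
        + (((pairsAt (below 2 (linkV d F)) (below 2 (linkV d G)) (σ \ S) : ℕ) : ℤ) : ℚ)) := by
  rw [coeff_ind_add_single_two_Rt_three_eq_blocks F G hd, ← sum_kap_eq_atomSum, ← sum_kap_eq_atomSumOne, ← sum_kap_eq_atomSumOne]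
  push_cast
  simp only [sum_add_distrib]
  ring

/-! ### Nonnegativity of the three atom sums for up-sets -/

/-- Atom sums over `V` only see the members inside `V`. [this work] -/
theorem atomSum_congr_of_agree (wJ wX wOx wOz wOO : ℕ → ℕ → ℕ → ℚ) {F F' G G' : Finset (Finset α)} (V : Finset α)
    (hF : ∀ S ⊆ V, (S ∈ F ↔ S ∈ F')) (hG : ∀ S ⊆ V, (S ∈ G ↔ S ∈ G')) :
    atomSum wJ wX wOx wOz wOO F G V = atomSum wJ wX wOx wOz wOO F' G' V := by
  unfold atomSum
  refine sum_congr rfl fun A hA => sum_congr rfl fun u hu => sum_congr rfl fun B hB => sum_congr rfl fun v hv => ?_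
  have hAV : A ⊆ V := mem_powerset.1 hA
  have hBV : B ⊆ V := mem_powerset.1 hB
  have huA : insert u A ⊆ V := insert_subset (mem_sdiff.1 hu).1 hAV
  have hvB : insert v B ⊆ V := insert_subset (mem_sdiff.1 hv).1 hBV
  unfold ιq
  simp only [hF A hAV, hF _ huA, hG B hBV, hG _ hvB]

omit [DecidableEq α] in
/-- Off `d`, the deletion agrees with the family. [this work] -/
theorem mem_delV_iff_of_not_mem [DecidableEq α] {d : α} {F : Finset (Finset α)} {S : Finset α} (hS : d ∉ S) :
    S ∈ delV d F ↔ S ∈ F := by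
  unfold delV; rw [mem_filter]; exact ⟨fun h => h.1, fun h => ⟨h, hS⟩⟩

/-- Off `d`, the link agrees with the (global up-set) `{S : S + d ∈ 𝒳}`. [this work] -/
theorem mem_linkV_iff_of_not_mem [Fintype α] {d : α} {F : Finset (Finset α)} {S : Finset α} (hS : d ∉ S) :
    S ∈ linkV d F ↔ S ∈ (univ.powerset.filter fun T : Finset α => insert d T ∈ F) := by
  unfold linkV
  simp only [mem_filter, mem_powerset, subset_erase, subset_univ, true_and, hS, not_false_eq_true, and_true]

/-- `{S : S + d ∈ 𝒳}` is an up-set when `𝒳` is. [this work] -/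
theorem isUpperSet_insert_mem [Fintype α] {F : Finset (Finset α)} (hF : IsUpperSet (F : Set (Finset α))) (d : α) :
    IsUpperSet (((univ.powerset.filter fun T : Finset α => insert d T ∈ F) : Finset (Finset α)) : Set (Finset α)) := by
  intro S T hST hS
  rw [mem_coe, mem_filter] at hS ⊢
  exact ⟨mem_powerset.2 (subset_univ _), hF (insert_subset_insert d hST) hS.2⟩

/-- **The three atom sums of the row with one doubled point are `≥ 0` for up-sets** (`d ∉ σ`; any nonnegative tables with zero off-`J` tables):
on `σ` the deletion `X⁰` agrees with `𝒳` and the link `X¹` with the up-set `{S : S + d ∈ 𝒳}`, so `atomSum_nonneg` applies. [this work] -/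
theorem atomSum_del_link_nonneg [Fintype α] {F G : Finset (Finset α)} (hF : IsUpperSet (F : Set (Finset α))) (hG : IsUpperSet (G : Set (Finset α)))
    {σ : Finset α} {d : α} (hd : d ∉ σ) (w : ℕ → ℕ → ℕ → ℚ) (hw : ∀ a b c, 0 ≤ w a b c) :
    0 ≤ atomSum w (fun _ _ _ => 0) (fun _ _ _ => 0) (fun _ _ _ => 0) (fun _ _ _ => 0) (linkV d F) (linkV d G) σ
    ∧ 0 ≤ atomSum w (fun _ _ _ => 0) (fun _ _ _ => 0) (fun _ _ _ => 0) (fun _ _ _ => 0) (delV d F) (linkV d G) σ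
    ∧ 0 ≤ atomSum w (fun _ _ _ => 0) (fun _ _ _ => 0) (fun _ _ _ => 0) (fun _ _ _ => 0) (linkV d F) (delV d G) σ := by
  have hnd : ∀ S ⊆ σ, d ∉ S := fun S hS hdS => hd (hS hdS)
  have hX1 : ∀ S ⊆ σ, (S ∈ linkV d F ↔ S ∈ (univ.powerset.filter fun T : Finset α => insert d T ∈ F)) :=
    fun S hS => mem_linkV_iff_of_not_mem (hnd S hS)
  have hZ1 : ∀ S ⊆ σ, (S ∈ linkV d G ↔ S ∈ (univ.powerset.filter fun T : Finset α => insert d T ∈ G)) :=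
    fun S hS => mem_linkV_iff_of_not_mem (hnd S hS)
  have hX0 : ∀ S ⊆ σ, (S ∈ delV d F ↔ S ∈ F) := fun S hS => mem_delV_iff_of_not_mem (hnd S hS)
  have hZ0 : ∀ S ⊆ σ, (S ∈ delV d G ↔ S ∈ G) := fun S hS => mem_delV_iff_of_not_mem (hnd S hS)
  have h0 : ∀ a b c : ℕ, (0 : ℚ) ≤ (fun _ _ _ => (0 : ℚ)) a b c := fun _ _ _ => le_rfl
  refine ⟨?_, ?_, ?_⟩
  · rw [atomSum_congr_of_agree _ _ _ _ _ σ hX1 hZ1]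
    exact atomSum_nonneg _ _ _ _ _ (isUpperSet_insert_mem hF d) (isUpperSet_insert_mem hG d) hw h0 h0 h0 h0 σ
  · rw [atomSum_congr_of_agree _ _ _ _ _ σ hX0 hZ1]
    exact atomSum_nonneg _ _ _ _ _ hF (isUpperSet_insert_mem hG d) hw h0 h0 h0 h0 σ
  · rw [atomSum_congr_of_agree _ _ _ _ _ σ hX1 hZ0]
    exact atomSum_nonneg _ _ _ _ _ (isUpperSet_insert_mem hF d) hG hw h0 h0 h0 h0 σ

end Summit.CriticalPhenomena.PercolationContinuityZ3.Theorems.SahiCTCForms
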